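import Summits.QuantumFields.BalabanUV.Beta.GAN24.CubicSectorCurrentExpansion

/-!
# `BalabanUV.Beta.GAN24.CubicSectorCurrentExpansionOfDecays` — binder row G-an2-4 ∕ (CONV-C), TRANSFER-III, the KERNEL-GENERIC twin of this lineage's `CubicSectorCurrentExpansion` §4 (g69):
# **THE SLOT∕LEG-WEIGHTED TWO-LEG CURRENT OF THE CUBIC SECTOR `e3OfK Lc X S`, FREE LEG SECOND, IS THE RESPONSE-WEIGHTED CURRENT OF `S` READ THROUGH ONE PASSIVE `X`**, for ANY decaying
# tame-symmetric kernel `X` ((DG) `Decays X CK δK`, (SG) `trK X = sgnK X`) in place of the dressed step kernel `G_j = coDressKBmAt ρ Lc (KInvStep Lc j)` — part 1 of the (III′) twin of the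
# (A)-tower induction step (part 2 = `CubicSectorCurrentSymOfWardLetters`, which adds the Ward response letters and the instance `X := GcombSh Lc j`).

NOT IN PRINT; OUR BOOKKEEPING ([folklore] `tsum` bookkeeping BY NAME over this lineage's g69 `CubicSectorCurrentExpansion` §1–§3 (`e3OfK_inl_inl_eq_neg_comp`, `tsum_slot_comp_right`,
`tsum_midleg_freeleg_comm`), `ExitFaceCurrentDescent` (`abs_legResponse_le`, `tsum_midleg_slot_comm`, `tsum_leg_comp_eq_neg_fieldResponse`), `ExitFaceCurrentDivBlockSum.tsum_leg_slot_comm`,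
`ExitFaceCurrentSectorSplit.abs_tsum_slot_locStencil_le`, `SlotWeightedVertex.tsum_slotWeight_vertexOfK`, an4's `OneStepKernelFamily.vertexFamily_vertexOfK ∕ colH`, an2's `biLoc_comp_right ∕
biLoc_comp_decays`; G-an2-4 CRUX TEAM (2), leaf prover `b2b-balaban-gan24-formalise-leaf-04`, gen 77).  HONEST FRAMING (cell contract, verbatim): «discharging `BetaPertH` makes Bałaban's UV
stability UNCONDITIONAL — a real constructive-QFT result; it is NOT the continuum limit and NOT the Clay problem.»  HONEST DEPENDENCY (verbatim): «continuum YM on T⁴ ⇐ BetaPertH ∧ nine spine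
estimates (0/9 proved); BetaPertH ⇐ (D1) ∧ (D4) ∧ CAP+tail; G-an2-4 gates asym, D1 and NE2/3/4.»

WHY.  The g69 expansion read the kernel `G_j` only through its decay (`decays_coDressKBmAt_KInvStep`) and its tame symmetry (`trK_coDressKBmAt_KInvStep`, consumed by the left contraction
`tsum_leg_comp_eq_neg_fieldResponse`) — every exchange lemma it calls is already kernel-generic.  At row D1's literal of record (III′) the cubic sector reads an2's comb-chart resolvent
`G′_j = GcombSh Lc j` (letters `decays_GcombSh`, `trK_GcombSh`), so the expansion is stated once over (DG)(SG).

WHAT ([folklore]; generic `d`, `[NeZero Lc]`, ANY local table family `S`, ANY `X` with (DG)(SG); 0 `def`, 0 cited facts, 0 `def … : Prop`, 0 sorry): **`faceSlot_current_eq_tsum_freeLeg_of_decays`**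
— for `|σ|, |ρ| ≤ 1` and a leg datum `ρ ê_β` with zero multiplier response under `X`: `Σ'_w ρ w·Σ'_t σ t·e3OfK Lc X S ν t w y (inl β)(inl μ) = Σ'_p Σ_a t(p,a)·X p (Lc•y) a (inr μ)`,
`t(p,a) := Σ_κ″ Σ'_q H_ρ(κ″,q)·Σ_κ‴ Σ'_u H_σ(κ‴,u)·S κ‴ u q p (inl κ″) a`, `H_ρ(κ″,q) = Σ'_w ρ w·colH X Lc β w κ″ q`, `H_σ` likewise, with the summability of the `p`-family (g69's proof token for
token).  Asserts NO value of Bałaban's tables; discharges NOTHING of (C)sym ∕ (hW, hWall) ∕ (hS, hSall); NEVER «G-an2-4 closed» as (CONV-C); NOT D1, NOT `BetaPertH`, NOT continuum, NOT Clay.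
2026-08-25; no existing file touched.
-/


noncomputable section

open Finset
open scoped BigOperators
open Literature.MathematicalPhysics.QuantumFieldTheory
open Literature.MathematicalPhysics.QuantumFieldTheory.Balaban1983to89
open Literature.MathematicalPhysics.QuantumFieldTheory.Balaban1983to89.Beta
open B12Sec2to5 (l1 l1_nonneg)
open ExpKernelCalculus (Site MKer comp Decays BiLoc Zl Zl_nonneg biLoc_comp_decays)
open AffineAveraging (box toSite)
open OneStepResolventKernel (Fib LocStencil biLoc_mono decays_mono)
open OneStepKernelFamily (vertexOfK colH vertexFamily_vertexOfK)
open BalabanStepJetsSucc (biLoc_comp_right)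
open Summit.QuantumFields.BalabanUV.Beta.TameKernelCalculus (trK)
open Summit.QuantumFields.BalabanUV.Beta.BorderedHessian (sgnK)
open Summit.QuantumFields.BalabanUV.Beta.SpineRooted (e3OfK e3OfK_apply)
open Summit.QuantumFields.BalabanUV.Beta.GAN24.ExitFaceCurrentDivBlockSum (tsum_leg_slot_comm)
open Summit.QuantumFields.BalabanUV.Beta.GAN24.ExitFaceCurrentDescent (abs_legResponse_le tsum_midleg_slot_comm tsum_leg_comp_eq_neg_fieldResponse)
open Summit.QuantumFields.BalabanUV.Beta.GAN24.ExitFaceCurrentSectorSplit (abs_tsum_slot_locStencil_le summable_slot_locStencil)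
open Summit.QuantumFields.BalabanUV.Beta.GAN24.SlotWeightedVertex (tsum_slotWeight_vertexOfK)
open Summit.QuantumFields.BalabanUV.Beta.GAN24.CubicSectorCurrentExpansion (e3OfK_inl_inl_eq_neg_comp tsum_slot_comp_right tsum_midleg_freeleg_comm)

namespace Summit.QuantumFields.BalabanUV.Beta.GAN24.CubicSectorCurrentExpansionOfDecays

variable {d : ℕ} {Lc : ℕ} [NeZero Lc] {S : Fin (d + 1) → (Fin (d + 1) → ℤ) → MKer (d + 1) (Fib d)} {Cs δs : ℝ} {X : MKer (d + 1) (Fib d)} {CK δK : ℝ}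

/-! ## The expansion through one passive `X` -/

/-- [folklore] **THE SLOT∕LEG-WEIGHTED CURRENT OF THE CUBIC SECTOR `e3OfK Lc X S`, FREE LEG SECOND, THROUGH ONE PASSIVE `X`** — this lineage's
`CubicSectorCurrentExpansion.faceSlot_current_eq_tsum_freeLeg` with the dressed step kernel `G_j` replaced by ANY decaying tame-symmetric kernel `X` ((DG) `Decays X CK δK`, (SG) `trK X = sgnK X`):
for `|σ|, |ρ| ≤ 1` and a leg datum `ρ ê_β` whose multiplier response under `X` vanishes,
`Σ'_w ρ w·Σ'_t σ t·e3OfK Lc X S ν t w y (inl β)(inl μ) = Σ'_p Σ_a (Σ_κ″ Σ'_q H_ρ(κ″,q)·Σ_κ‴ Σ'_u H_σ(κ‴,u)·S κ‴ u q p (inl κ″) a)·X p (Lc•y) a (inr μ)`,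
`H_ρ(κ″,q) = Σ'_w ρ w·colH X Lc β w κ″ q`, `H_σ(κ‴,u) = Σ'_t σ t·colH X Lc ν t κ‴ u`; the `p`-family on the right is summable (proof token for token). -/
theorem faceSlot_current_eq_tsum_freeLeg_of_decays (hG : Decays X CK δK) (hδK : 0 < δK) (hKt : trK X = sgnK X) (hS : LocStencil S Cs δs) (hδs : 0 < δs)
    {σ ρ : Site (d + 1) → ℝ} (hσ : ∀ t, |σ t| ≤ 1) (hρ : ∀ w, |ρ w| ≤ 1) (ν β : Fin (d + 1))
    (hM : ∀ (m : Fin (d + 1)) (q : Site (d + 1)), ∑' w : Site (d + 1), ρ w * X q ((Lc : ℤ) • w) (Sum.inr m) (Sum.inr β) = 0)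
    (y : Site (d + 1)) (μ : Fin (d + 1)) :
    (Summable fun p : Site (d + 1) => ∑ a : Fib d,
      (∑ κ₂ : Fin (d + 1), ∑' q : Site (d + 1), (∑' w : Site (d + 1), ρ w * colH X Lc β w κ₂ q) *
        ∑ κ₃ : Fin (d + 1), ∑' u : Site (d + 1), (∑' t : Site (d + 1), σ t * colH X Lc ν t κ₃ u) *
          S κ₃ u q p (Sum.inl κ₂) a) * X p ((Lc : ℤ) • y) a (Sum.inr μ)) ∧
    ∑' w : Site (d + 1), ρ w * ∑' t : Site (d + 1), σ t * e3OfK Lc X S ν t w y (Sum.inl β) (Sum.inl μ) =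
      ∑' p : Site (d + 1), ∑ a : Fib d,
        (∑ κ₂ : Fin (d + 1), ∑' q : Site (d + 1), (∑' w : Site (d + 1), ρ w * colH X Lc β w κ₂ q) *
          ∑ κ₃ : Fin (d + 1), ∑' u : Site (d + 1), (∑' t : Site (d + 1), σ t * colH X Lc ν t κ₃ u) *
            S κ₃ u q p (Sum.inl κ₂) a) * X p ((Lc : ℤ) • y) a (Sum.inr μ) := by
  classical
  have hLc : 1 ≤ Lc := Nat.one_le_iff_ne_zero.mpr (NeZero.ne Lc)
  -- constants: decay of `X`, bi-localisation of the vertex family, of `𝒱 ∘ X` and of `X ∘ (𝒱 ∘ X)`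
  have hCK : 0 ≤ CK := hG.nonneg (Sum.inl 0)
  have hCs : 0 ≤ Cs := (hS 0 0).nonneg (Sum.inl 0)
  obtain ⟨m, hm0, hmK, hmS⟩ : ∃ m : ℝ, 0 < m ∧ m ≤ δK ∧ m ≤ δs := ⟨min δK δs, lt_min hδK hδs, min_le_left _ _, min_le_right _ _⟩
  have hG1 : Decays X CK m := decays_mono hG hCK le_rfl hmK
  have hG2 : Decays X CK (m / 2) := decays_mono hG hCK le_rfl (by linarith)
  have hG3 : Decays X CK (m / 4) := decays_mono hG hCK le_rfl (by linarith)
  have hS1 : LocStencil S Cs m := fun κ u => biLoc_mono (hS κ u) hCs hmS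
  have hV := vertexFamily_vertexOfK (N := Lc) hG1 hCK hS1 hm0 le_rfl
  have hW : ∀ t : Site (d + 1), BiLoc (comp (vertexOfK X Lc S ν t) X)
      ((Lc : ℤ) • t) ((Lc : ℤ) • t) _ (m / 4) := fun t => biLoc_comp_right (hV ν t) hG2 (by positivity) (by linarith)
  have hY : ∀ t : Site (d + 1), BiLoc (comp X
      (comp (vertexOfK X Lc S ν t) X))
      ((Lc : ℤ) • t) ((Lc : ℤ) • t) _ (m / 8) := fun t => biLoc_comp_decays hG3 (hW t) (by positivity) (by linarith)
  -- the two responses are bounded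
  have hH : ∀ (κ₂ : Fin (d + 1)) (q : Site (d + 1)), |∑' w : Site (d + 1), ρ w * colH X Lc β w κ₂ q| ≤
      1 * CK * (Real.exp (m / 4 * ((Lc : ℝ) * (d + 1))) * Zl (d + 1) (m / 4)) := fun κ₂ q => abs_legResponse_le hG3 (by positivity) hρ β κ₂ q
  have hHσ : ∀ (κ₃ : Fin (d + 1)) (u : Site (d + 1)), |∑' t : Site (d + 1), σ t * colH X Lc ν t κ₃ u| ≤
      1 * CK * (Real.exp (m / 4 * ((Lc : ℝ) * (d + 1))) * Zl (d + 1) (m / 4)) := fun κ₃ u => abs_legResponse_le hG3 (by positivity) hσ ν κ₃ u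
  -- the level-`j` two-leg current decays in `|p − q|`, the passive factor decays from `Lc•y`
  have hT : ∀ (κ₂ : Fin (d + 1)) (q p : Site (d + 1)) (a : Fib d),
      |∑ κ₃ : Fin (d + 1), ∑' u : Site (d + 1), (∑' t : Site (d + 1), σ t * colH X Lc ν t κ₃ u) * S κ₃ u q p (Sum.inl κ₂) a| ≤
        ((d + 1 : ℕ) * ((1 * CK * (Real.exp (m / 4 * ((Lc : ℝ) * (d + 1))) * Zl (d + 1) (m / 4))) * Cs * Zl (d + 1) (δs / 2))) * Real.exp (-(δs / 2) * l1 (p - q)) := by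
    intro κ₂ q p a
    calc _ ≤ ∑ κ₃ : Fin (d + 1), |∑' u : Site (d + 1), (∑' t : Site (d + 1), σ t * colH X Lc ν t κ₃ u) * S κ₃ u q p (Sum.inl κ₂) a| :=
          Finset.abs_sum_le_sum_abs _ _
      _ ≤ ∑ _κ₃ : Fin (d + 1), ((1 * CK * (Real.exp (m / 4 * ((Lc : ℝ) * (d + 1))) * Zl (d + 1) (m / 4))) * Cs * Zl (d + 1) (δs / 2)) * Real.exp (-(δs / 2) * l1 (p - q)) :=
          Finset.sum_le_sum fun κ₃ _ => abs_tsum_slot_locStencil_le hS hδs (hHσ κ₃) κ₃ q p (Sum.inl κ₂) a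
      _ = _ := by rw [Finset.sum_const, Finset.card_univ, Fintype.card_fin, nsmul_eq_mul]; ring
  have hg : ∀ (p : Site (d + 1)) (a : Fib d), |X p ((Lc : ℤ) • y) a (Sum.inr μ)| ≤ CK * Real.exp (-δK * l1 (p - (Lc : ℤ) • y)) :=
    fun p a => hG p _ a _
  -- (1) pointwise; (2) the `(w,t)` exchange; (3) the `w`-contraction of the LEFT resolvent
  have e1 : ∀ w t : Site (d + 1), e3OfK Lc X S ν t w y (Sum.inl β) (Sum.inl μ) =
      -(comp X (comp (vertexOfK X Lc S ν t)
        X) ((Lc : ℤ) • w) ((Lc : ℤ) • y) (Sum.inr β) (Sum.inr μ)) :=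
    fun w t => e3OfK_inl_inl_eq_neg_comp hG2 (by positivity) ν (hV ν t) w y β μ
  have e2 := tsum_leg_slot_comm hY (by positivity) hσ hρ ((Lc : ℤ) • y) (Sum.inr β) (Sum.inr μ)
  have e3 : ∀ t : Site (d + 1), ∑' w : Site (d + 1), ρ w * comp X
      (comp (vertexOfK X Lc S ν t) X)
        ((Lc : ℤ) • w) ((Lc : ℤ) • y) (Sum.inr β) (Sum.inr μ) =
      -(∑ κ₂ : Fin (d + 1), ∑' q : Site (d + 1), (∑' w : Site (d + 1), ρ w * colH X Lc β w κ₂ q) *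
        comp (vertexOfK X Lc S ν t) X q ((Lc : ℤ) • y) (Sum.inl κ₂) (Sum.inr μ)) :=
    fun t => tsum_leg_comp_eq_neg_fieldResponse hLc hG3 (by positivity) hKt (hW t) (by positivity) hρ β hM ((Lc : ℤ) • y) (Sum.inr μ)
  -- (4) the `(q,t)` exchange; (5) the `(t,p)` exchange and the vertex opened; (6) the `(q,p)` exchange
  have hF := fun κ₂ : Fin (d + 1) => tsum_midleg_slot_comm
    (V := fun t => comp (vertexOfK X Lc S ν t) X)
    hW (by positivity) hσ (hH κ₂) ((Lc : ℤ) • y) (Sum.inl κ₂) (Sum.inr μ)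
  have e5 := fun (κ₂ : Fin (d + 1)) (q : Site (d + 1)) => (tsum_slot_comp_right (V := fun t => vertexOfK X Lc S ν t)
    (fun t => hV ν t) (by positivity) hG hδK.le hσ q ((Lc : ℤ) • y) (Sum.inl κ₂) (Sum.inr μ)).2
  have e5' := fun (q p : Site (d + 1)) (κ₂ : Fin (d + 1)) (a : Fib d) => tsum_slotWeight_vertexOfK hLc hG1 hm0 hS1 hm0 hσ ν q p (Sum.inl κ₂) a
  have e6 := fun κ₂ : Fin (d + 1) => tsum_midleg_freeleg_comm (hH κ₂) (half_pos hδs) (hT κ₂) hδK hg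
  refine ⟨?_, ?_⟩
  · -- summability of the final `p`-family: finite sum over `κ₂` of the summable families of (6), regrouped
    have h := summable_sum (s := (Finset.univ : Finset (Fin (d + 1)))) fun κ₂ _ => (e6 κ₂).2.1
    refine h.congr fun p => ?_
    rw [Finset.sum_comm]
    refine Finset.sum_congr rfl fun a _ => ?_
    rw [Finset.sum_mul]
  · calc ∑' w : Site (d + 1), ρ w * ∑' t : Site (d + 1), σ t * e3OfK Lc X S ν t w y (Sum.inl β) (Sum.inl μ)
        = -(∑' t : Site (d + 1), σ t * ∑' w : Site (d + 1), ρ w * comp X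
            (comp (vertexOfK X Lc S ν t) X)
            ((Lc : ℤ) • w) ((Lc : ℤ) • y) (Sum.inr β) (Sum.inr μ)) := by
          rw [← e2, ← tsum_neg]
          refine tsum_congr fun w => ?_
          rw [← mul_neg, ← tsum_neg]
          congr 1
          exact tsum_congr fun t => by rw [e1 w t, mul_neg]
      _ = ∑' t : Site (d + 1), σ t * ∑ κ₂ : Fin (d + 1), ∑' q : Site (d + 1),
            (∑' w : Site (d + 1), ρ w * colH X Lc β w κ₂ q) *
              comp (vertexOfK X Lc S ν t) X q ((Lc : ℤ) • y) (Sum.inl κ₂) (Sum.inr μ) := by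
          rw [← tsum_neg]
          exact tsum_congr fun t => by rw [e3 t, mul_neg, neg_neg]
      _ = ∑ κ₂ : Fin (d + 1), ∑' t : Site (d + 1), σ t * ∑' q : Site (d + 1),
            (∑' w : Site (d + 1), ρ w * colH X Lc β w κ₂ q) *
              comp (vertexOfK X Lc S ν t) X q ((Lc : ℤ) • y) (Sum.inl κ₂) (Sum.inr μ) := by
          rw [← Summable.tsum_finsetSum (fun κ₂ _ => (hF κ₂).1)]
          exact tsum_congr fun t => Finset.mul_sum _ _ _
      _ = ∑ κ₂ : Fin (d + 1), ∑' q : Site (d + 1), (∑' w : Site (d + 1), ρ w * colH X Lc β w κ₂ q) *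
            ∑' p : Site (d + 1), ∑ a : Fib d,
              (∑ κ₃ : Fin (d + 1), ∑' u : Site (d + 1), (∑' t : Site (d + 1), σ t * colH X Lc ν t κ₃ u) * S κ₃ u q p (Sum.inl κ₂) a) *
                X p ((Lc : ℤ) • y) a (Sum.inr μ) := by
          refine Finset.sum_congr rfl fun κ₂ _ => ?_
          rw [(hF κ₂).2]
          refine tsum_congr fun q => ?_
          rw [e5 κ₂ q]
          congr 1
          refine tsum_congr fun p => Finset.sum_congr rfl fun a _ => ?_
          rw [e5' q p κ₂ a]
      _ = ∑ κ₂ : Fin (d + 1), ∑' p : Site (d + 1), ∑ a : Fib d,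
            (∑' q : Site (d + 1), (∑' w : Site (d + 1), ρ w * colH X Lc β w κ₂ q) *
              ∑ κ₃ : Fin (d + 1), ∑' u : Site (d + 1), (∑' t : Site (d + 1), σ t * colH X Lc ν t κ₃ u) * S κ₃ u q p (Sum.inl κ₂) a) *
                X p ((Lc : ℤ) • y) a (Sum.inr μ) :=
          Finset.sum_congr rfl fun κ₂ _ => (e6 κ₂).2.2
      _ = _ := by
          rw [← Summable.tsum_finsetSum (fun κ₂ _ => (e6 κ₂).2.1)]
          refine tsum_congr fun p => ?_
          rw [Finset.sum_comm]
          refine Finset.sum_congr rfl fun a _ => ?_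
          rw [Finset.sum_mul]


end Summit.QuantumFields.BalabanUV.Beta.GAN24.CubicSectorCurrentExpansionOfDecays

end
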